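import Summits.ValiantsHypothesis.ValiantsHypothesis.Theses.FifoMatching
import Summits.ValiantsHypothesis.ValiantsHypothesis.Theses.DivisionGap
import Literature.Computability.AlgebraicComplexity.NestFreeMatchingPoly

/-!
# Route `FifoMatching`, deciding crux `NNNotVP` (stmt-ValiantsHypothesis-11615) — what the division
# split REALLY consumes: the 0/1-transfer AT THE SINGLE FAMILY `NN`, and hardness SOMEWHERE

The registered line `Cruxes/NNNotVP/Lines/division_split.lean` closes the crux from the stub
`stub_zeroOneTransfer` = `Theses.DivisionGap.ZeroOneTransfer` (item stmt-5066: the 0/1-transfer for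
EVERY 0/1-coefficient family whose complexification is in `VP_ℂ`) and `Theses.FifoMatching.NNDivisionHard`
(item stmt-21181: for every `c`, for ALL LARGE `n`, every nonzero cofactor `h` has
`2^((log₂ n + c)^c) < L₊(NN_n · h) + L₊(h)`), via the landed glue `NNNotVPSplit.nnNotVP_of_subs`.

This file records, BY NAME and sorry-free, that the glue consumes much less than the two registered
statements, and that on the transfer side it consumes EXACTLY what the crux gives back:

* the **transfer at `NN`** (`TransferAtNN`, inline): IF `NN ∈ VP_ℂ` THEN for some `c` and all `n`
  some nonzero `h` has `L₊(NN_n · h) + L₊(h) ≤ 2^((log₂ n + c)^c)` — the instance `σ n := Fin 2n × Fin 2n`,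
  `f n := NN_n` of `ZeroOneTransfer` (`transferAtNN_of_zeroOneTransfer`);
* **hardness somewhere** (`SomewhereHard`, inline): for every `c` there is SOME level `n` at which
  every nonzero cofactor is expensive — implied by `NNDivisionHard` (`somewhereHard_of_nnDivisionHard`,
  take `n := n₀`) and EQUIVALENT to its infinitely-often form (`ioHard_iff_somewhereHard`: a level
  with all certificates above `2^(c'^c')` is automatically large, by the free certificate `h := 1`).

Results:

* `nnNotVP_of_transferAtNN_of_somewhereHard : TransferAtNN → SomewhereHard → NNNotVP` (the glue,
  with both hypotheses weakened);
* `transferAtNN_of_nnNotVP : NNNotVP → TransferAtNN` (the transfer at `NN` is IMPLIED by the crux —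
  vacuously: its hypothesis `NN ∈ VP_ℂ` is the negation of the crux);
* `nnNotVP_iff_transferAtNN : SomewhereHard → (NNNotVP ↔ TransferAtNN)` and
  `nnNotVP_iff_transferAtNN_of_nnDivisionHard : NNDivisionHard → (NNNotVP ↔ TransferAtNN)`:
  MODULO the division-hardness piece (item 21181, even in its somewhere/i.o. form) the deciding
  crux IS the single-family transfer, no more and no less.

Consequence for the planner (honest framing, no route verb issued here): the registered stub Z =
`ZeroOneTransfer` quantifies over ALL 0/1 `VP_ℂ` families and is exposed to a kill at an unrelated
family (the tree's `ZeroOneTransfer.Negative.zeroOneTransfer_false_of_triangularDimers_hard`: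
super-quasi-polynomial division hardness of Valiant's triangular dimers refutes Z) — such a kill
would end the LINE `division_split` but says nothing about the crux, whereas `TransferAtNN` cannot
be refuted without refuting `NNNotVP` itself (`transferAtNN_of_nnNotVP`).  On the hardness side a
prover of 21181-type bounds may work at levels `n` of any convenient special form (no padding
argument is needed for the crux): `SomewhereHard` suffices.

Nothing here is progress on `NNDivisionHard`, `ZeroOneTransfer`, `NNNotVP` or `VP ≠ VNP` (all OPEN);
no definitions, no named facts (the two auxiliary statements are hypotheses spelled out inline).
-/

noncomputable section

-- Sub = Summit single-conjunct layout: the duplicated namespace component is mandated by the tree.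
set_option linter.dupNamespace false

namespace Summit.ValiantsHypothesis.ValiantsHypothesis.Theorems.FifoMatching.NNNotVP.TransferAtNN

open MvPolynomial Literature.Computability.AlgebraicComplexity
open scoped NNReal

/-! ### The glue with weakened hypotheses -/

/-- **`TransferAtNN → SomewhereHard → NNNotVP`.**  If `NN ∈ VP_ℂ` (the negation of the crux; the
route's inline `NN_n` over `ℂ` is definitionally the library's `nestFreeMatchingPoly n ℂ`), the
transfer at `NN` gives `c` with a certificate `L₊(NN_n · h) + L₊(h) ≤ 2^((log₂ n + c)^c)` at EVERY
level `n`; hardness somewhere at this `c` gives a level where every certificate is strictly above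
that bound — contradiction.  Both hypotheses are inline: the first is the instance `f := NN` of
`Theses.DivisionGap.ZeroOneTransfer`, the second is `Theses.FifoMatching.NNDivisionHard` with
«for all large `n`» weakened to «for some `n`». [folklore] -/
theorem nnNotVP_of_transferAtNN_of_somewhereHard
    (hT : IsVPFamily (k := ℂ) (fun n => nestFreeMatchingPoly n ℂ) →
      ∃ c : ℕ, ∀ n : ℕ, ∃ h : MvPolynomial (Fin (2 * n) × Fin (2 * n)) ℝ≥0, h ≠ 0 ∧
        complexity (nestFreeMatchingPoly n ℝ≥0 * h) + complexity h ≤ 2 ^ ((Nat.log 2 n + c) ^ c))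
    (hS : ∀ c : ℕ, ∃ n : ℕ, ∀ h : MvPolynomial (Fin (2 * n) × Fin (2 * n)) ℝ≥0, h ≠ 0 →
      2 ^ ((Nat.log 2 n + c) ^ c) < complexity (nestFreeMatchingPoly n ℝ≥0 * h) + complexity h) :
    Summit.ValiantsHypothesis.ValiantsHypothesis.Theses.FifoMatching.NNNotVP := by
  intro hVP
  obtain ⟨c, hc⟩ := hT hVP
  obtain ⟨n, hn⟩ := hS c
  obtain ⟨h, hh, hle⟩ := hc n
  exact absurd (lt_of_lt_of_le (hn h hh) hle) (lt_irrefl _)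

/-! ### The hardness side: `NNDivisionHard ⇒ SomewhereHard ⇔ infinitely-often hardness -/

/-- **`NNDivisionHard → SomewhereHard`**: eventual hardness gives hardness at the level `n₀` itself
(the route's inline `NN_n` over `ℝ≥0` is definitionally `nestFreeMatchingPoly n ℝ≥0`). [folklore] -/
theorem somewhereHard_of_nnDivisionHard
    (hNN : Summit.ValiantsHypothesis.ValiantsHypothesis.Theses.FifoMatching.NNDivisionHard) :
    ∀ c : ℕ, ∃ n : ℕ, ∀ h : MvPolynomial (Fin (2 * n) × Fin (2 * n)) ℝ≥0, h ≠ 0 →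
      2 ^ ((Nat.log 2 n + c) ^ c) < complexity (nestFreeMatchingPoly n ℝ≥0 * h) + complexity h := by
  intro c
  obtain ⟨n₀, hn₀⟩ := hNN c
  exact ⟨n₀, fun h hh => hn₀ n₀ le_rfl h hh⟩

/-- **`NNDivisionHard →` infinitely-often hardness** (for every `c` and `n₀` a level `n ≥ n₀` at
which every nonzero cofactor is expensive): immediate from eventual hardness. [folklore] -/
theorem ioHard_of_nnDivisionHard
    (hNN : Summit.ValiantsHypothesis.ValiantsHypothesis.Theses.FifoMatching.NNDivisionHard) :
    ∀ c n₀ : ℕ, ∃ n ≥ n₀, ∀ h : MvPolynomial (Fin (2 * n) × Fin (2 * n)) ℝ≥0, h ≠ 0 →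
      2 ^ ((Nat.log 2 n + c) ^ c) < complexity (nestFreeMatchingPoly n ℝ≥0 * h) + complexity h := by
  intro c n₀
  obtain ⟨n₁, hn₁⟩ := hNN c
  exact ⟨max n₀ n₁, le_max_left _ _, fun h hh => hn₁ _ (le_max_right _ _) h hh⟩

/-- **Hardness somewhere ⇔ hardness infinitely often.**  `⇐` is trivial.  `⇒`: given `c` and `n₀`,
let `B` bound the free certificates `L₊(NN_n · 1) + L₊(1)` at the finitely many levels `n < n₀` and
pick `c' ≥ c` with `B ≤ 2^(c'^c')`; a level `n` at which EVERY certificate exceeds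
`2^((log₂ n + c')^(c')) ≥ 2^(c'^c')` cannot be `< n₀` (test `h := 1`), and at that level the
certificates also exceed the smaller `2^((log₂ n + c)^c)`. [folklore] -/
theorem ioHard_iff_somewhereHard :
    (∀ c n₀ : ℕ, ∃ n ≥ n₀, ∀ h : MvPolynomial (Fin (2 * n) × Fin (2 * n)) ℝ≥0, h ≠ 0 →
      2 ^ ((Nat.log 2 n + c) ^ c) < complexity (nestFreeMatchingPoly n ℝ≥0 * h) + complexity h) ↔
    (∀ c : ℕ, ∃ n : ℕ, ∀ h : MvPolynomial (Fin (2 * n) × Fin (2 * n)) ℝ≥0, h ≠ 0 →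
      2 ^ ((Nat.log 2 n + c) ^ c) < complexity (nestFreeMatchingPoly n ℝ≥0 * h) + complexity h) := by
  constructor
  · intro hio c
    obtain ⟨n, -, hn⟩ := hio c 0
    exact ⟨n, hn⟩
  · intro hS c n₀
    -- the free certificates below level `n₀`
    let F : ℕ → ℕ := fun n =>
      complexity (nestFreeMatchingPoly n ℝ≥0 * 1) + complexity (1 : MvPolynomial (Fin (2 * n) × Fin (2 * n)) ℝ≥0)
    let B : ℕ := (Finset.range n₀).sup F
    -- a constant `c' ≥ c` with `B ≤ 2 ^ (c' ^ c')`
    let c' : ℕ := max c (B + 1)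
    have hc'c : c ≤ c' := le_max_left _ _
    have hB : B < 2 ^ (c' ^ c') := by
      have h1 : B + 1 ≤ c' := le_max_right _ _
      have h2 : c' ≤ c' ^ c' := by
        rcases Nat.eq_zero_or_pos c' with h0 | hpos
        · simp [h0]
        · exact Nat.le_self_pow (by omega) c'
      calc B < B + 1 := Nat.lt_succ_self _
        _ ≤ c' ^ c' := h1.trans h2
        _ < 2 ^ (c' ^ c') := Nat.lt_two_pow_self
    obtain ⟨n, hn⟩ := hS c'
    refine ⟨n, ?_, fun h hh => ?_⟩
    · -- `n < n₀` is impossible: the free certificate at level `n` is `≤ B < 2^(c'^c') ≤ 2^((log₂ n + c')^c')`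
      by_contra hle
      have hlt : n < n₀ := not_le.mp hle
      have h1 := hn 1 one_ne_zero
      have hF : F n ≤ B := Finset.le_sup (f := F) (Finset.mem_range.mpr hlt)
      have hpow : 2 ^ (c' ^ c') ≤ 2 ^ ((Nat.log 2 n + c') ^ c') :=
        Nat.pow_le_pow_right (by norm_num) (Nat.pow_le_pow_left (by omega) c')
      have : F n < F n := by
        calc F n ≤ B := hF
          _ < 2 ^ (c' ^ c') := hB
          _ ≤ 2 ^ ((Nat.log 2 n + c') ^ c') := hpow
          _ < F n := h1
      exact lt_irrefl _ this
    · -- monotonicity of the quasi-polynomial scale in the constant (tree: `logLevel_mono`)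
      have hc'pos : 0 < c' := lt_of_lt_of_le (Nat.succ_pos B) (le_max_right _ _)
      have hmono : (Nat.log 2 n + c) ^ c ≤ (Nat.log 2 n + c') ^ c' := by
        rcases Nat.eq_zero_or_pos c with h0 | hc
        · rw [h0, pow_zero]
          exact Nat.one_le_pow _ _ (by omega)
        · calc (Nat.log 2 n + c) ^ c ≤ (Nat.log 2 n + c') ^ c := Nat.pow_le_pow_left (by omega) c
            _ ≤ (Nat.log 2 n + c') ^ c' := Nat.pow_le_pow_right (by omega) hc'c
      calc 2 ^ ((Nat.log 2 n + c) ^ c) ≤ 2 ^ ((Nat.log 2 n + c') ^ c') :=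
            Nat.pow_le_pow_right (by norm_num) hmono
        _ < complexity (nestFreeMatchingPoly n ℝ≥0 * h) + complexity h := hn h hh

/-! ### The transfer side: `ZeroOneTransfer ⇒ TransferAtNN ⇐ NNNotVP` -/

/-- **`ZeroOneTransfer → TransferAtNN`**: the registered stub Z specialised to the single family
`σ n := Fin 2n × Fin 2n`, `f n := NN_n` (0/1 coefficients: `coeff_nestFreeMatchingPoly_eq_zero_or_eq_one`;
complexification `= NN_n` over `ℂ`: `map_nestFreeMatchingPoly`). [folklore] -/
theorem transferAtNN_of_zeroOneTransfer
    (hZ : Summit.ValiantsHypothesis.ValiantsHypothesis.Theses.DivisionGap.ZeroOneTransfer) :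
    IsVPFamily (k := ℂ) (fun n => nestFreeMatchingPoly n ℂ) →
      ∃ c : ℕ, ∀ n : ℕ, ∃ h : MvPolynomial (Fin (2 * n) × Fin (2 * n)) ℝ≥0, h ≠ 0 ∧
        complexity (nestFreeMatchingPoly n ℝ≥0 * h) + complexity h ≤ 2 ^ ((Nat.log 2 n + c) ^ c) := by
  intro hVP
  have hcoeff : ∀ (n : ℕ) (m : (Fin (2 * n) × Fin (2 * n)) →₀ ℕ),
      MvPolynomial.coeff m (nestFreeMatchingPoly n ℝ≥0) = 0 ∨
      MvPolynomial.coeff m (nestFreeMatchingPoly n ℝ≥0) = 1 :=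
    fun n m => coeff_nestFreeMatchingPoly_eq_zero_or_eq_one n m
  have hmap : (fun n => MvPolynomial.map (Complex.ofRealHom.comp NNReal.toRealHom)
        (nestFreeMatchingPoly n ℝ≥0)) = fun n => nestFreeMatchingPoly n ℂ := by
    funext n
    exact map_nestFreeMatchingPoly n _
  have hVP' : IsVPFamily (k := ℂ)
      (fun n => MvPolynomial.map (Complex.ofRealHom.comp NNReal.toRealHom)
        (nestFreeMatchingPoly n ℝ≥0)) := by
    rw [hmap]
    exact hVP
  exact hZ (fun n => Fin (2 * n) × Fin (2 * n)) (fun n => nestFreeMatchingPoly n ℝ≥0) hcoeff hVP'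

/-- **`NNNotVP → TransferAtNN`**: the transfer at `NN` is IMPLIED by the crux, vacuously — its
hypothesis `NN ∈ VP_ℂ` (the route's inline `NN_n` over `ℂ` is definitionally `nestFreeMatchingPoly n ℂ`)
is the negation of the crux.  Hence `TransferAtNN` can only be refuted by refuting the crux, in
contrast with the registered general stub `ZeroOneTransfer`. [folklore] -/
theorem transferAtNN_of_nnNotVP
    (hX : Summit.ValiantsHypothesis.ValiantsHypothesis.Theses.FifoMatching.NNNotVP) :
    IsVPFamily (k := ℂ) (fun n => nestFreeMatchingPoly n ℂ) →
      ∃ c : ℕ, ∀ n : ℕ, ∃ h : MvPolynomial (Fin (2 * n) × Fin (2 * n)) ℝ≥0, h ≠ 0 ∧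
        complexity (nestFreeMatchingPoly n ℝ≥0 * h) + complexity h ≤ 2 ^ ((Nat.log 2 n + c) ^ c) := by
  intro hVP
  exact absurd hVP hX

/-! ### Modulo hardness somewhere, the crux IS the transfer at `NN` -/

/-- **`SomewhereHard → (NNNotVP ↔ TransferAtNN)`**: modulo division hardness of `NN` at some level
for every quasi-polynomial scale (implied by item stmt-21181), the deciding crux of route
`FifoMatching` is EQUIVALENT to the 0/1-transfer at the single family `NN`. [folklore] -/
theorem nnNotVP_iff_transferAtNN
    (hS : ∀ c : ℕ, ∃ n : ℕ, ∀ h : MvPolynomial (Fin (2 * n) × Fin (2 * n)) ℝ≥0, h ≠ 0 →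
      2 ^ ((Nat.log 2 n + c) ^ c) < complexity (nestFreeMatchingPoly n ℝ≥0 * h) + complexity h) :
    Summit.ValiantsHypothesis.ValiantsHypothesis.Theses.FifoMatching.NNNotVP ↔
      (IsVPFamily (k := ℂ) (fun n => nestFreeMatchingPoly n ℂ) →
        ∃ c : ℕ, ∀ n : ℕ, ∃ h : MvPolynomial (Fin (2 * n) × Fin (2 * n)) ℝ≥0, h ≠ 0 ∧
          complexity (nestFreeMatchingPoly n ℝ≥0 * h) + complexity h ≤ 2 ^ ((Nat.log 2 n + c) ^ c)) :=
  ⟨transferAtNN_of_nnNotVP, fun hT => nnNotVP_of_transferAtNN_of_somewhereHard hT hS⟩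

/-- **`NNDivisionHard → (NNNotVP ↔ TransferAtNN)`**: with the registered piece item stmt-21181 as
the hypothesis.  The registered stub Z (`ZeroOneTransfer`, all 0/1 `VP_ℂ` families) implies the
right-hand side (`transferAtNN_of_zeroOneTransfer`) but is not implied by the crux. [folklore] -/
theorem nnNotVP_iff_transferAtNN_of_nnDivisionHard
    (hNN : Summit.ValiantsHypothesis.ValiantsHypothesis.Theses.FifoMatching.NNDivisionHard) :
    Summit.ValiantsHypothesis.ValiantsHypothesis.Theses.FifoMatching.NNNotVP ↔
      (IsVPFamily (k := ℂ) (fun n => nestFreeMatchingPoly n ℂ) →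
        ∃ c : ℕ, ∀ n : ℕ, ∃ h : MvPolynomial (Fin (2 * n) × Fin (2 * n)) ℝ≥0, h ≠ 0 ∧
          complexity (nestFreeMatchingPoly n ℝ≥0 * h) + complexity h ≤ 2 ^ ((Nat.log 2 n + c) ^ c)) :=
  nnNotVP_iff_transferAtNN (somewhereHard_of_nnDivisionHard hNN)

/-- **The landed glue recovered** (`ZeroOneTransfer → NNDivisionHard → NNNotVP`, cf.
`NNNotVPSplit.nnNotVP_of_subs`) as the composition of the two weakenings. [folklore] -/
theorem nnNotVP_of_zeroOneTransfer_of_nnDivisionHard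
    (hZ : Summit.ValiantsHypothesis.ValiantsHypothesis.Theses.DivisionGap.ZeroOneTransfer)
    (hNN : Summit.ValiantsHypothesis.ValiantsHypothesis.Theses.FifoMatching.NNDivisionHard) :
    Summit.ValiantsHypothesis.ValiantsHypothesis.Theses.FifoMatching.NNNotVP :=
  nnNotVP_of_transferAtNN_of_somewhereHard (transferAtNN_of_zeroOneTransfer hZ)
    (somewhereHard_of_nnDivisionHard hNN)

end Summit.ValiantsHypothesis.ValiantsHypothesis.Theorems.FifoMatching.NNNotVP.TransferAtNN

end
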